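import Literature.Topology.FourManifolds.LatticeFormsWallGenerators
import Literature.Topology.FourManifolds.LatticeFormsEichlerTransitivity
import HarnessLib

/-!
# `O(Q ⊕ H)` is generated by Kirby's transvections and `O(Q) ⊕ 1` (Wall 1963; GHS 2009, Prop. 3.3 (iii))

Topic `Literature/Topology/FourManifolds`; the conclusion, for the lattices `Q ⊕ H` of Kirby's
proof of Thm. X.2 (`WallDiffeomorphisms.lean`, `LatticeFormsWallGenerators.lean`), of the line
`LatticeFormsTransvections` → `LatticeFormsEichlerCriterion` → `LatticeFormsEichlerTransitivity`:
Gritsenko–Hulek–Sankaran, *Abelianisation of orthogonal groups and the fundamental group of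
modular varieties*, J. Algebra 322 (2009), Prop. 3.3 (iii) — "`O(L) = ⟨E_U(L₁), O(L₁)⟩`" for
`L = U ⊕ L₁`, `L₁ ⊇ U₁` a second hyperbolic plane, "(iii) was proved in [Wa] for unimodular
lattices", [Wa] = C. T. C. Wall, *On the orthogonal groups of unimodular quadratic forms II*,
J. reine angew. Math. 213 (1963), Kirby's reference [Wall4] for the generation step of his proof
("see [Wall1], page 136, and [Wall2,4]", p. 62).

**Theorem** (`exists_eq_prodCongr_trans_transvectionAEquiv_trans_evalEquiv`). Let `Q` be a
symmetric, even integral bilinear form on `V` containing a hyperbolic pair `x₁, y₁`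
(`x₁² = y₁² = 0`, `x₁·y₁ = 1`). Then every isometry `φ` of `Q ⊕ H` factors as
`φ = (ψ ⊕ 1_H) · A_a · w` — in diagrammatic order `((ψ ⊕ 1).trans A_a).trans w` — with `ψ` an
isometry of `Q`, `A_a` one of Kirby's transvections (`transvectionAEquiv`, `a·a = 2q`) and `w`
an admissible word in the Eichler transvections `E(y, b, q)`, `E(x, b, q)` based at the standard
hyperbolic pair `x, y` of `H` with `b ⊥ x, y` (`UGen.evalEquiv`); and every such admissible
generator is one of Kirby's `A_b`, `A'_b` (`UGen.toLinearMap_eq_transvectionA`,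
`UGen.toLinearMap_eq_transvectionA'`). So `O(Q ⊕ H)` is generated by the `A_b`, the `A'_b` and
`O(Q) ⊕ 1_H`. Proof as printed (GHS p. 469): `φ(y)` is isotropic with dual vector `φ(x)`, so the
Eichler criterion (`exists_uGens_apply_eq`) gives an admissible word `τ` with `τ(φ(y)) = y`;
then `τ φ` lies in the stabiliser of `y`, which is `(O(Q) ⊕ 1) · {A_a}`
(`exists_eq_prodCongr_trans_transvectionAEquiv_of_apply_hypY`). No unimodularity is used.

What this leaves of the generation theorem quoted by Kirby (for `Q_N` indefinite or of rank
`≤ 8`, `O(Q_N ⊕ H)` is generated by the `A_w`, `A'_w` and the automorphisms coming from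
`S² × S²`): (a) `O(Q_N) ⊕ 1 ⊆ ⟨A, A', 1 ⊕ O(H)⟩` and (b) the cases where `Q_N` is odd or contains
no hyperbolic plane (definite of rank `≤ 8`) — Wall 1962/1963/1964 p. 136, not held.
Everything here is proved; no named fact is introduced.

## Sources

* V. Gritsenko, K. Hulek, G. K. Sankaran, J. Algebra 322 (2009) 463–478, arXiv:0810.1614,
  Prop. 3.3 (iii) and its proof. [GritsenkoHulekSankaran2009]
* R. C. Kirby, *The topology of 4-manifolds*, LNM 1374 (1989), Ch. X, proof of Thm. 2, p. 62.
  [Kirby1989]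
* C. T. C. Wall, *On the orthogonal groups of unimodular quadratic forms II*, J. reine angew.
  Math. 213 (1963) 122–136 (not held; cited through GHS and Kirby).
-/

noncomputable section

open Module
open LinearMap (BilinForm)
open LinearMap.BilinForm (IsometryEquiv)

namespace Literature.Topology.FourManifolds

variable {V : Type*} [AddCommGroup V] {Q : BilinForm ℤ V}

/-! ### `Q ⊕ H` with a hyperbolic pair in `Q` has two orthogonal hyperbolic pairs -/

/-- If `Q` contains a hyperbolic pair `x₁, y₁` then `(x, y) = (hypX, hypY)` and
`((x₁, 0), (y₁, 0))` are two orthogonal hyperbolic pairs of `Q ⊕ H`. [folklore] -/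
theorem twoHyperbolicPairs_prod_hyperbolic (hQ : Q.IsSymm) {x₁ y₁ : V} (hx₁ : Q x₁ x₁ = 0)
    (hy₁ : Q y₁ y₁ = 0) (hx₁y₁ : Q x₁ y₁ = 1) :
    TwoHyperbolicPairs (Q.prod hyperbolicForm) hypX hypY (x₁, 0) (y₁, 0) where
  isSymm := hQ.prod isSymm_hyperbolicForm
  xx := prod_hyperbolic_hypX_hypX Q
  yy := prod_hyperbolic_hypY_hypY Q
  xy := prod_hyperbolic_hypX_hypY Q
  x₁x₁ := by rw [prod_hyperbolic_inl_inl, hx₁]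
  y₁y₁ := by rw [prod_hyperbolic_inl_inl, hy₁]
  x₁y₁ := by rw [prod_hyperbolic_inl_inl, hx₁y₁]
  xx₁ := prod_hyperbolic_hypX_inl Q x₁
  xy₁ := prod_hyperbolic_hypX_inl Q y₁
  yx₁ := prod_hyperbolic_hypY_inl Q x₁
  yy₁ := prod_hyperbolic_hypY_inl Q y₁

/-- `Q ⊕ H` is even when `Q` is (`H` being even). [folklore] -/
theorem isEven_prod_hyperbolic (hev : Q.IsEven) : (Q.prod hyperbolicForm).IsEven :=
  LinearMap.BilinForm.isEven_prod_iff.2 ⟨hev, isEven_hyperbolicForm⟩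

/-! ### Admissible generators on `Q ⊕ H` are Kirby's `A_b`, `A'_b` -/

/-- A vector of `Q ⊕ H` orthogonal to `x` and `y` lies in the summand `Q`: `b = (b_Q, 0)`.
[folklore] -/
theorem eq_inl_of_ortho {b : V × (Fin 2 → ℤ)} (hx : Q.prod hyperbolicForm hypX b = 0)
    (hy : Q.prod hyperbolicForm hypY b = 0) : b = (b.1, 0) := by
  simp [hypX, hyperbolicForm_apply] at hx
  simp [hypY, hyperbolicForm_apply] at hy
  refine Prod.ext rfl ?_
  ext i
  fin_cases i
  · exact hy
  · exact hx

/-- An admissible generator `E(y, b, q)` of `Q ⊕ H` is Kirby's `A_{b_Q}` (and `b_Q · b_Q = 2q`).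
[cite: Kirby1989, Ch. X, proof of Thm. 2 (p. 62)] -/
theorem UGen.toLinearMap_eq_transvectionA {b : V × (Fin 2 → ℤ)} {q : ℤ}
    (hg : (UGen.atY b q).IsAdmissible (Q.prod hyperbolicForm) hypX hypY) :
    (UGen.atY b q).toLinearMap (Q.prod hyperbolicForm) hypX hypY = transvectionA Q b.1 q ∧
      Q b.1 b.1 = q + q := by
  obtain ⟨hx, hy, hq⟩ := hg
  have hb := eq_inl_of_ortho hx hy
  refine ⟨?_, ?_⟩
  · change (Q.prod hyperbolicForm).eichlerTransvection hypY b q = _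
    rw [hb]
    rfl
  · rw [hb, prod_hyperbolic_inl_inl] at hq
    exact hq

/-- An admissible generator `E(x, b, q)` of `Q ⊕ H` is Kirby's `A'_{b_Q}` (and `b_Q · b_Q = 2q`).
[cite: Kirby1989, Ch. X, proof of Thm. 2 (p. 62)] -/
theorem UGen.toLinearMap_eq_transvectionA' {b : V × (Fin 2 → ℤ)} {q : ℤ}
    (hg : (UGen.atX b q).IsAdmissible (Q.prod hyperbolicForm) hypX hypY) :
    (UGen.atX b q).toLinearMap (Q.prod hyperbolicForm) hypX hypY = transvectionA' Q b.1 q ∧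
      Q b.1 b.1 = q + q := by
  obtain ⟨hx, hy, hq⟩ := hg
  have hb := eq_inl_of_ortho hx hy
  refine ⟨?_, ?_⟩
  · change (Q.prod hyperbolicForm).eichlerTransvection hypX b q = _
    rw [hb]
    rfl
  · rw [hb, prod_hyperbolic_inl_inl] at hq
    exact hq

/-! ### The generation theorem for `O(Q ⊕ H)` -/

/-- **`O(Q ⊕ H) = ⟨A, A', O(Q) ⊕ 1⟩` (GHS 2009, Prop. 3.3 (iii); Wall 1963).** For `Q` symmetric
and even with a hyperbolic pair `x₁, y₁`, every isometry `φ` of `Q ⊕ H` is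
`((ψ ⊕ 1_H).trans A_a).trans w` for an isometry `ψ` of `Q`, a Kirby transvection `A_a`
(`a·a = 2q`) and an admissible word `w` in the transvections `E(y, b, q')`, `E(x, b, q')`,
`b ⊥ x, y` — each of which is an `A_b` or `A'_b` (`UGen.toLinearMap_eq_transvectionA`,
`UGen.toLinearMap_eq_transvectionA'`). Proof as printed: the Eichler criterion
(`exists_uGens_apply_eq`, applied to the isotropic vector `φ(y)` with dual vector `φ(x)`) gives
an admissible word `τ` with `τ(φ(y)) = y`; the stabiliser of `y` is `(O(Q) ⊕ 1) · {A_a}`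
(`exists_eq_prodCongr_trans_transvectionAEquiv_of_apply_hypY`); and `w = τ⁻¹` is again an
admissible word. [cite: GritsenkoHulekSankaran2009, Prop. 3.3 (iii)] -/
theorem exists_eq_prodCongr_trans_transvectionAEquiv_trans_evalEquiv (hQ : Q.IsSymm)
    (hev : Q.IsEven) {x₁ y₁ : V} (hx₁ : Q x₁ x₁ = 0) (hy₁ : Q y₁ y₁ = 0) (hx₁y₁ : Q x₁ y₁ = 1)
    (φ : (Q.prod hyperbolicForm).IsometryEquiv (Q.prod hyperbolicForm)) :
    ∃ (l : List (UGen (V × (Fin 2 → ℤ))))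
      (hl : ∀ g ∈ l, g.IsAdmissible (Q.prod hyperbolicForm) hypX hypY)
      (a : V) (q : ℤ) (hq : Q a a = q + q) (ψ : Q.IsometryEquiv Q),
      φ = ((ψ.prodCongr (IsometryEquiv.refl hyperbolicForm)).trans
        (transvectionAEquiv hQ a q hq)).trans
        (UGen.evalEquiv (hQ.prod isSymm_hyperbolicForm) (prod_hyperbolic_hypX_hypX Q)
          (prod_hyperbolic_hypY_hypY Q) l hl) := by
  have h2 := twoHyperbolicPairs_prod_hyperbolic hQ hx₁ hy₁ hx₁y₁
  have hB : (Q.prod hyperbolicForm).IsSymm := hQ.prod isSymm_hyperbolicForm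
  -- `φ y` is isotropic with dual vector `φ x`
  have hu : Q.prod hyperbolicForm (φ hypY) (φ hypY) = 0 := by
    rw [φ.map_app, prod_hyperbolic_hypY_hypY]
  have huz : Q.prod hyperbolicForm (φ hypY) (φ hypX) = 1 := by
    rw [φ.map_app, prod_hyperbolic_hypY_hypX]
  -- the Eichler criterion: an admissible word `τ` with `τ (φ y) = y`
  obtain ⟨l, hl, hly⟩ := exists_uGens_apply_eq h2 (isEven_prod_hyperbolic hev) hu huz
  set τ := UGen.evalEquiv hB (prod_hyperbolic_hypX_hypX Q) (prod_hyperbolic_hypY_hypY Q) l hl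
    with hτ
  -- `τ φ` fixes `y`, hence lies in `(O(Q) ⊕ 1) · {A_a}`
  have hχ : (φ.trans τ) hypY = hypY := by
    rw [IsometryEquiv.trans_apply, hτ, UGen.evalEquiv_apply, hly]
  obtain ⟨a, q, hq, ψ, hψ⟩ :=
    exists_eq_prodCongr_trans_transvectionAEquiv_of_apply_hypY hQ (φ.trans τ) hχ
  -- `φ = (τ φ) τ⁻¹`, and `τ⁻¹` is the admissible word `invWord l`
  have hl' : ∀ g ∈ UGen.invWord l, g.IsAdmissible (Q.prod hyperbolicForm) hypX hypY :=
    fun g hg => UGen.isAdmissible_of_mem_invWord hl hg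
  refine ⟨UGen.invWord l, hl', a, q, hq, ψ, DFunLike.ext _ _ fun u => ?_⟩
  rw [← hψ, IsometryEquiv.trans_apply, IsometryEquiv.trans_apply, UGen.evalEquiv_apply, hτ,
    UGen.evalEquiv_apply,
    UGen.eval_invWord_eval hB (prod_hyperbolic_hypX_hypX Q) (prod_hyperbolic_hypY_hypY Q) hl]

end Literature.Topology.FourManifolds

end
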